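import Summits.NavierStokesRegularity.NavierStokesRegularity.Theses.DssFarFieldSlaving
import Literature.Analysis.FluidPDE.ChaeWolfRemovingDSSProofs
import HarnessLib

/-!
# Rotated DSS with a twist of finite order is plain DSS with a longer period; Chae–Wolf's
  fine-ratio exclusion for such twists (route `DssFarFieldSlaving`, crux `BlowupTypeIDssProfile`,
  stmt-NavierStokesRegularity-0155 — SUPPORT: symmetry bookkeeping + a certified-empty corner)

For the object of the crux — a Type-I rotated `c`-DSS ancient solution, `c R⁻¹ u(c²t, cRx) = u(t,x)`
(`IsRotatedDSS c R u`, `R` any linear isometry of `ℝ³`) — this file records: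

* `isRotatedDSS_one_one`, `isRotatedDSS_mul` — rotated discrete self-similarities compose:
  `(c, R)` and `(d, S)` give `(c·d, S * R)` (group law of `E ≃ₗᵢ[ℝ] E`, `(S * R) x = S (R x)`);
* `isRotatedDSS_pow` — hence `(cⁿ, Rⁿ)` for every `n`;
* `isDiscretelySelfSimilar_pow_of_isRotatedDSS` — if the twist has finite order, `R ^ q = 1`, then `u`
  is plainly `c^q`-DSS (`IsDiscretelySelfSimilar (c ^ q) u`): the case "R of finite order" of the
  rotated Liouville problem is the plain problem at the factor `c^q` (Bradshaw–Tsai 2017, §1: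
  RDSS with phase `φ ∈ 2πℚ`);
* `rdss_finiteOrder_removing` — consequently Chae–Wolf's fine-ratio exclusion (Thm 1.3, the tree's
  DISCHARGED `chaeWolf2017_removing_dss_holds`) covers finite-order twists: for every `C₀ > 0`
  there is `c₁ > 1` such that every classical rotated `c`-DSS solution on `ℝ³ × (−∞,0)` with
  `R ^ q = 1`, `0 < q`, `c ^ q < c₁` and the Type-I bound with constant `C₀` vanishes identically.

Cell pub-ns-dss (PLAN §8 X-b): a candidate with a finite-order twist must report `c^q` against
`c₁(C₀)` exactly as a plain DSS candidate reports `c`.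

## References

* Z. Bradshaw, T.-P. Tsai, Comm. PDE 42 (2017) = arXiv:1610.05680, §1 (RDSS fields, phase and
  factor). [BradshawTsai2017CPDE]
* D. Chae, J. Wolf, Comm. PDE 42 (2017) 1359–1374 = arXiv:1610.09464, Thm 1.3.
  [ChaeWolf2017RemovingDSS]
-/

noncomputable section

set_option linter.dupNamespace false

namespace Summit.NavierStokesRegularity.NavierStokesRegularity.Theorems

open MeasureTheory Set Function Literature.Analysis.FluidPDE

variable {E : Type*} [NormedAddCommGroup E] [NormedSpace ℝ E]

/-- The trivial rotated self-similarity: factor `1`, twist `1`. [folklore] -/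
theorem isRotatedDSS_one_one (u : ℝ → E → E) : IsRotatedDSS 1 (1 : E ≃ₗᵢ[ℝ] E) u := by
  intro t x
  have h1 : (((1 : E ≃ₗᵢ[ℝ] E).symm : E ≃ₗᵢ[ℝ] E) : E → E) = id := by
    rw [← LinearIsometryEquiv.coe_inv, inv_one, LinearIsometryEquiv.coe_one]
  rw [h1]
  simp

/-- **Composition of rotated discrete self-similarities**: if `u` is `(c, R)`-RDSS and `(d, S)`-RDSS
then it is `(c·d, S * R)`-RDSS, where `(S * R) x = S (R x)` (insert the `(d, S)` identity at the
point `(c²t, cRx)` of the `(c, R)` identity). [cite: BradshawTsai2017CPDE, §1 (rotated discretely self-similar fields)] -/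
theorem isRotatedDSS_mul {c d : ℝ} {R S : E ≃ₗᵢ[ℝ] E} {u : ℝ → E → E} (hc : IsRotatedDSS c R u)
    (hd : IsRotatedDSS d S u) : IsRotatedDSS (c * d) (S * R) u := by
  intro t x
  have hsymm : ∀ v, (S * R).symm v = R.symm (S.symm v) := fun v => by
    apply (S * R).injective
    simp
  have e1 : (c * d) ^ 2 * t = d ^ 2 * (c ^ 2 * t) := by ring
  have e2 : (c * d) • (S * R) x = d • S (c • R x) := by
    rw [LinearIsometryEquiv.coe_mul, Function.comp_apply, LinearIsometryEquiv.map_smul, smul_smul,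
      mul_comm c d]
  rw [e1, e2, hsymm, ← hc t x, ← hd (c ^ 2 * t) (c • R x), LinearIsometryEquiv.map_smul, smul_smul,
    LinearIsometryEquiv.map_smul, smul_smul]

/-- **Powers**: a `(c, R)`-RDSS field is `(cⁿ, Rⁿ)`-RDSS for every `n` (iterate the defining
identity). [cite: BradshawTsai2017CPDE, §1 (rotated discretely self-similar fields)] -/
theorem isRotatedDSS_pow {c : ℝ} {R : E ≃ₗᵢ[ℝ] E} {u : ℝ → E → E} (h : IsRotatedDSS c R u) :
    ∀ n : ℕ, IsRotatedDSS (c ^ n) (R ^ n) u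
  | 0 => by simpa using isRotatedDSS_one_one u
  | n + 1 => by
      have key := isRotatedDSS_mul h (isRotatedDSS_pow h n)
      rw [show c * c ^ n = c ^ n * c from mul_comm _ _] at key
      rw [pow_succ, pow_succ]
      exact key

/-- **A twist of finite order is no twist at a longer period**: if `u` is `(c, R)`-RDSS and
`R ^ q = 1` then `u` is plainly `c^q`-discretely self-similar (Bradshaw–Tsai 2017, §1: for a phase
in `2πℚ` an RDSS field is DSS with a larger factor). [cite: BradshawTsai2017CPDE, §1 (rotated discretely self-similar fields)] -/
theorem isDiscretelySelfSimilar_pow_of_isRotatedDSS {c : ℝ} {R : E ≃ₗᵢ[ℝ] E} {u : ℝ → E → E}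
    (h : IsRotatedDSS c R u) {q : ℕ} (hq : R ^ q = 1) : IsDiscretelySelfSimilar (c ^ q) u := by
  have key := isRotatedDSS_pow h q
  rw [hq, LinearIsometryEquiv.one_def] at key
  exact isRotatedDSS_refl_iff.1 key

/-- **Chae–Wolf's fine-ratio exclusion covers finite-order twists** (Chae–Wolf 2017, Thm 1.3, the
tree's discharged `chaeWolf2017_removing_dss_holds`, applied at the factor `c^q`): for every
`C₀ > 0` there is `c₁ > 1` such that every classical solution `(u, p)` of Navier–Stokes (`ν = 1`,
no force) on `ℝ³ × (−∞, 0)` which is rotated `c`-DSS for an isometry `R` of finite order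
`R ^ q = 1`, `0 < q`, with `1 < c`, `c ^ q < c₁` and the Type-I bound
`‖u(t,x)‖ ≤ C₀/(‖x‖ + √(−t))` vanishes identically on `t < 0`. [cite: ChaeWolf2017RemovingDSS, Theorem 1.3 (arXiv:1610.09464 p. 3)] -/
theorem rdss_finiteOrder_removing {C₀ : ℝ} (hC₀ : 0 < C₀) :
    ∃ c₁ : ℝ, 1 < c₁ ∧
      ∀ (c : ℝ) (R : EuclideanSpace ℝ (Fin 3) ≃ₗᵢ[ℝ] EuclideanSpace ℝ (Fin 3)) (q : ℕ)
        (u : ℝ → EuclideanSpace ℝ (Fin 3) → EuclideanSpace ℝ (Fin 3))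
        (p : ℝ → EuclideanSpace ℝ (Fin 3) → ℝ),
        1 < c → R ^ q = 1 → 0 < q → c ^ q < c₁ →
        IsClassicalNSSolutionOn (Iio 0) 1 0 u p → IsRotatedDSS c R u → HasTypeIDecay C₀ u →
        ∀ t < 0, ∀ x, u t x = 0 := by
  obtain ⟨c₁, hc₁, H⟩ := chaeWolf2017_removing_dss_holds C₀ hC₀
  refine ⟨c₁, hc₁, fun c R q u p hc hRq hq hlt hcl hrdss hI => ?_⟩
  have hcq : 1 < c ^ q := one_lt_pow₀ hc (Nat.pos_iff_ne_zero.1 hq)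
  exact H (c ^ q) hcq hlt u p hcl (isDiscretelySelfSimilar_pow_of_isRotatedDSS hrdss hRq) hI

end Summit.NavierStokesRegularity.NavierStokesRegularity.Theorems

end
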